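import Literature.NumberTheory.EllipticCurves.SingularCubic
import Literature.NumberTheory.EllipticCurves.GaloisAction
import Literature.NumberTheory.GaloisRepresentations.AbsGaloisGroup
import HarnessLib

/-!
# The nodal cubic `y² = x³ + a x²`: its group of non-singular points as a Galois module

Topic `EllipticCurves`; companion of `SingularCubic` (Silverman, *AEC*, Prop. III.2.5: for a
Weierstrass cubic with a node, `E_ns ≅ K̄ˣ` via `(x, y) ↦ (y - α₁x - β₁)/(y - α₂x - β₂)`) and of
`GaloisAction` (the action of `Γ_F = Gal(F̄/F)` on `E(F̄) = geomPoints W`).  For the cubic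
`W_a : y² = x³ + a x²` over a field `F` (`WeierstrassCurve.nodalCubic a`; `Δ = 0`,
`c₄ = 16 a²`, singular point `S = (0, 0)`, tangent lines `y = ± √a · x`) this file records
Silverman's isomorphism over `F̄` **together with its behaviour under `Γ_F`**, which is the
content of *AEC* Exercise 3.5 (the node is *split* iff `√a ∈ F`; in general `E_ns` is the torus
`F̄ˣ` twisted by the quadratic character of `F(√a)/F`):

* `nodalCubic.baseChange_eq_singularModel` — over any `L ∋ s` with `s² = a`,
  `W_a ⊗ L = singularModel 0 0 s (-s)` literally;
* `nodalCubic.nodeMap a : geomPoints (nodalCubic a) →+ Additive F̄ˣ` — Silverman's map for the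
  slopes `(√a, -√a)` (`√a = nodalCubic.sqrt a`, a fixed square root in `F̄`), bijective when
  `2a ≠ 0` (`nodeMap_bijective`), with the explicit formula
  `nodeMap (x, y) = (y - √a·x)/(y + √a·x)` (`coe_nodeMap_some`);
* `nodalCubic.smul_sqrt_eq_or` — every `σ ∈ Γ_F` maps `√a` to `± √a`;
* `nodalCubic.coe_nodeMap_smul_of_smul_sqrt_eq` / `…_eq_neg` — **the twist**:
  `nodeMap (σ • P) = σ (nodeMap P)` if `σ √a = √a`, and `nodeMap (σ • P) = σ (nodeMap P)⁻¹` if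
  `σ √a = -√a`;
* `nodalCubic.nsmul_eq_zero_iff` — `n • P = 0 ↔ (nodeMap P) ^ n = 1` (torsion points correspond
  to roots of unity), `finite_torsionBy` (`E_ns(F̄)[n]` is finite for every `n ≥ 1`, as it embeds
  into the `n`-th roots of unity of `F̄`);
* `nodalCubic.smul_eq_self_of_smul_sqrt_eq`, `nodalCubic.smul_eq_neg_of_smul_sqrt_eq_neg` — if `σ`
  fixes the `n`-th roots of unity, then on `E_ns(F̄)[n]` it acts as the identity, resp. as `-1`,
  according as `σ √a = √a` or `σ √a = -√a`.

These are the inputs of the computation of the `ℓ`-adic representation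
`V_ℓ(E_ns(F̄)) ≅ ℚ_ℓ(1) ⊗ χ_a` of a non-split node (a sibling file on its Tate module), which
settles by counterexample what the conductor schemas of `BSDConductor` / `HasseWeilAbelian`
assert at singular Weierstrass equations (`BSDConductorSingularProofs`).

Mathlib has the nodal/cuspidal classification only through `c₄`, `Δ` and the group law on
`Affine.Point`; it has no `E_ns ≅ K̄ˣ` (that is the tree's `SingularCubic`) and nothing on the
Galois structure of `E_ns` (`lean search` for `nodal`, `node`, `twist` near `Point`: no hits).

## References

* J. H. Silverman, *The Arithmetic of Elliptic Curves*, 2nd ed., GTM 106 (2009), Prop. III.2.5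
  and Exercise 3.5 (PDF pp. 59, 105 of the held copy). [SilvermanAEC2009]

## Design

`noncomputable section`, `open scoped Classical` (Mathlib's group law on points wants
`DecidableEq`, instantiated classically as in `GaloisAction`, `PointDivisibility`), one universe
`u`.  Silverman's map is obtained from `singularModel.nodeHom` by transport along the *equality of
curves* `baseChange_eq_singularModel` (a `subst` on a generic curve, `exists_nodeHom_of_eq`), and
then fixed by choice (`nodeMap`); only its three properties (homomorphism, bijective, formula on
affine points) are used afterwards.  Deliberate dot-notation extensions of Mathlib's
`WeierstrassCurve` namespace, API in `namespace WeierstrassCurve.nodalCubic`.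
-/

noncomputable section

open scoped Classical AddSubgroup

universe u

namespace WeierstrassCurve

variable {F : Type u} [Field F]

/-- The nodal cubic `W_a : y² = x³ + a x²` over `F` (`a₁ = a₃ = a₄ = a₆ = 0`, `a₂ = a`): for
`a ≠ 0` (and `2 ≠ 0`) a Weierstrass cubic with a node at `(0, 0)` and tangent lines
`y = ± √a · x`, split iff `a` is a square in `F`.  Silverman, *AEC*, Prop. III.2.5 and
Exercise 3.5. [cite: SilvermanAEC2009, Prop. III.2.5 and Exercise 3.5] -/
def nodalCubic (a : F) : WeierstrassCurve F where
  a₁ := 0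
  a₂ := a
  a₃ := 0
  a₄ := 0
  a₆ := 0

namespace nodalCubic

variable (a : F)

/-- Unfolding `a₁ = 0`. [folklore] -/
@[simp] theorem a₁_eq : (nodalCubic a).a₁ = 0 := rfl
/-- Unfolding `a₂ = a`. [folklore] -/
@[simp] theorem a₂_eq : (nodalCubic a).a₂ = a := rfl
/-- Unfolding `a₃ = 0`. [folklore] -/
@[simp] theorem a₃_eq : (nodalCubic a).a₃ = 0 := rfl
/-- Unfolding `a₄ = 0`. [folklore] -/
@[simp] theorem a₄_eq : (nodalCubic a).a₄ = 0 := rfl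
/-- Unfolding `a₆ = 0`. [folklore] -/
@[simp] theorem a₆_eq : (nodalCubic a).a₆ = 0 := rfl

/-- `Δ(W_a) = 0`: the cubic `y² = x³ + a x²` is singular. Silverman, *AEC*, Prop. III.1.4(a).
[folklore] -/
theorem Δ_eq : (nodalCubic a).Δ = 0 := by
  simp only [Δ, b₂, b₄, b₆, b₈, a₁_eq, a₂_eq, a₃_eq, a₄_eq, a₆_eq]
  ring

/-- `c₄(W_a) = 16 a²`: for `2a ≠ 0` the singularity is a node. Silverman, *AEC*,
Prop. III.1.4(a). [folklore] -/
theorem c₄_eq : (nodalCubic a).c₄ = 16 * a ^ 2 := by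
  simp only [c₄, b₂, b₄, a₁_eq, a₂_eq, a₃_eq, a₄_eq]
  ring

/-- `W_a` is not an elliptic curve (`Δ = 0`). [folklore] -/
theorem not_isElliptic : ¬ (nodalCubic a).IsElliptic := fun h ↦
  h.isUnit.ne_zero (Δ_eq a)

/-- **Normal form over a field containing `√a`.**  If `s² = a` in an `F`-algebra `L` (a field),
then `W_a ⊗ L` *is* the singular model `singularModel 0 0 s (-s)` of `SingularCubic`
(`(y - 0)² - (s + (-s)) x y + s(-s) x² = x³`, i.e. `y² = x³ + s² x²`).
Silverman, *AEC*, proof of Prop. III.2.5. [folklore] -/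
theorem baseChange_eq_singularModel {L : Type u} [Field L] [Algebra F L] {s : L}
    (hs : s ^ 2 = algebraMap F L a) :
    (nodalCubic a).baseChange L = singularModel 0 0 s (-s) := by
  ext
  · simp [nodalCubic, baseChange, singularModel]
  · simp only [baseChange, map_a₂, a₂_eq, singularModel]
    rw [← hs]; ring
  · simp [nodalCubic, baseChange, singularModel]
  · simp [nodalCubic, baseChange, singularModel]
  · simp [nodalCubic, baseChange, singularModel]

/-- Transport of `singularModel.nodeHom` along an equality of curves: a Weierstrass cubic `V`
*equal* to `singularModel x₀ y₀ α₁ α₂` with `α₁ ≠ α₂` carries Silverman's isomorphism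
`E_ns ≅ Lˣ`, `(x, y) ↦ (y - y₀ - α₁(x - x₀))/(y - y₀ - α₂(x - x₀))` (a bijective homomorphism
with this formula on affine points).  Silverman, *AEC*, Prop. III.2.5(a). [folklore] -/
theorem exists_nodeHom_of_eq {L : Type u} [Field L] (V : WeierstrassCurve L) (x₀ y₀ α₁ α₂ : L)
    (hV : V = singularModel x₀ y₀ α₁ α₂) (hα : α₁ ≠ α₂) :
    ∃ φ : V.toAffine.Point →+ Additive Lˣ, Function.Bijective φ ∧
      ∀ {x y : L} (h : V.toAffine.Nonsingular x y),
        ((Additive.toMul (φ (.some x y h)) : Lˣ) : L) =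
          (y - y₀ - α₁ * (x - x₀)) / (y - y₀ - α₂ * (x - x₀)) := by
  subst hV
  exact ⟨singularModel.nodeHom x₀ y₀ α₁ α₂,
    ⟨singularModel.nodeHom_injective hα, singularModel.nodeHom_surjective hα⟩, fun _ ↦ rfl⟩

/-! ### Over the algebraic closure: the node map and the Galois action -/

/-- A fixed square root `√a` of `a` in `F̄` (`IsAlgClosed.exists_pow_nat_eq`). [folklore] -/
def sqrt : AlgebraicClosure F :=
  (IsAlgClosed.exists_pow_nat_eq (algebraMap F (AlgebraicClosure F) a) two_pos).choose

/-- `(√a)² = a` in `F̄`. [folklore] -/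
theorem sqrt_sq : sqrt a ^ 2 = algebraMap F (AlgebraicClosure F) a :=
  (IsAlgClosed.exists_pow_nat_eq (algebraMap F (AlgebraicClosure F) a) two_pos).choose_spec

variable {a}

/-- For `2a ≠ 0` in `F` the two slopes `√a ≠ -√a` are distinct (the singularity is a node).
[folklore] -/
theorem sqrt_ne_neg (ha : 2 * a ≠ 0) : sqrt a ≠ -sqrt a := by
  intro h
  have h2 : (2 : AlgebraicClosure F) * sqrt a = 0 := by linear_combination h
  rcases mul_eq_zero.mp h2 with h0 | h0
  · apply ha
    have : (algebraMap F (AlgebraicClosure F)) (2 * a) = 0 := by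
      rw [map_mul, map_ofNat, h0, zero_mul]
    exact (algebraMap F (AlgebraicClosure F)).injective (this.trans (map_zero _).symm)
  · apply ha
    have : (algebraMap F (AlgebraicClosure F)) a = 0 := by
      rw [← sqrt_sq, h0, zero_pow two_ne_zero]
    rw [(algebraMap F (AlgebraicClosure F)).injective (this.trans (map_zero _).symm), mul_zero]

variable (a)

/-- `E_ns(F̄) = geomPoints (nodalCubic a)` is the point type of `singularModel 0 0 √a (-√a)` up to
the equality of curves `baseChange_eq_singularModel`. [folklore] -/
theorem baseChange_algebraicClosure_eq :
    (nodalCubic a).baseChange (AlgebraicClosure F) = singularModel 0 0 (sqrt a) (-sqrt a) :=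
  baseChange_eq_singularModel a (sqrt_sq a)

/-- Existence of Silverman's isomorphism on `E_ns(F̄)` for the slopes `(√a, -√a)`, with its
formula, when `2a ≠ 0`. Silverman, *AEC*, Prop. III.2.5(a). [cite: SilvermanAEC2009, Prop. III.2.5(a)] -/
theorem exists_nodeMap (ha : 2 * a ≠ 0) :
    ∃ φ : ((nodalCubic a).baseChange (AlgebraicClosure F)).toAffine.Point →+
      Additive (AlgebraicClosure F)ˣ, Function.Bijective φ ∧
      ∀ {x y : AlgebraicClosure F}
        (h : ((nodalCubic a).baseChange (AlgebraicClosure F)).toAffine.Nonsingular x y),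
        ((Additive.toMul (φ (.some x y h)) : (AlgebraicClosure F)ˣ) : AlgebraicClosure F) =
          (y - sqrt a * x) / (y + sqrt a * x) := by
  obtain ⟨φ, hφ, hφ'⟩ := exists_nodeHom_of_eq ((nodalCubic a).baseChange (AlgebraicClosure F))
    0 0 (sqrt a) (-sqrt a) (baseChange_algebraicClosure_eq a) (sqrt_ne_neg ha)
  refine ⟨φ, hφ, fun h ↦ (hφ' h).trans ?_⟩
  ring_nf

/-- **Silverman's map `E_ns(F̄) → F̄ˣ` for the nodal cubic `y² = x³ + a x²`** (slopes `(√a, -√a)`;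
written additively): a chosen homomorphism as in `exists_nodeMap` when `2a ≠ 0`, and the zero map
otherwise (junk value, never used). Silverman, *AEC*, Prop. III.2.5(a).
[cite: SilvermanAEC2009, Prop. III.2.5(a)] -/
def nodeMap : geomPoints (nodalCubic a) →+ Additive (AlgebraicClosure F)ˣ :=
  if ha : 2 * a ≠ 0 then (exists_nodeMap a ha).choose else 0

variable {a}

/-- The node map is bijective (`2a ≠ 0`). Silverman, *AEC*, Prop. III.2.5(a).
[cite: SilvermanAEC2009, Prop. III.2.5(a)] -/
theorem nodeMap_bijective (ha : 2 * a ≠ 0) : Function.Bijective (nodeMap a) := by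
  rw [nodeMap, dif_pos ha]
  exact (exists_nodeMap a ha).choose_spec.1

/-- The node map is injective (`2a ≠ 0`). [cite: SilvermanAEC2009, Prop. III.2.5(a)] -/
theorem nodeMap_injective (ha : 2 * a ≠ 0) : Function.Injective (nodeMap a) :=
  (nodeMap_bijective ha).1

/-- **The formula**: on an affine (non-singular) point, `nodeMap (x, y) = (y - √a x)/(y + √a x)`.
Silverman, *AEC*, Prop. III.2.5(a). [cite: SilvermanAEC2009, Prop. III.2.5(a)] -/
theorem coe_nodeMap_some (ha : 2 * a ≠ 0) {x y : AlgebraicClosure F}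
    (h : ((nodalCubic a).baseChange (AlgebraicClosure F)).toAffine.Nonsingular x y) :
    ((Additive.toMul (nodeMap a (.some x y h)) : (AlgebraicClosure F)ˣ) : AlgebraicClosure F) =
      (y - sqrt a * x) / (y + sqrt a * x) := by
  rw [nodeMap, dif_pos ha]
  exact (exists_nodeMap a ha).choose_spec.2 h

/-- On an affine point both `y - √a x` and `y + √a x` are non-zero (the value of the node map is
a unit). [folklore] -/
theorem sub_ne_zero_and_add_ne_zero (ha : 2 * a ≠ 0) {x y : AlgebraicClosure F}
    (h : ((nodalCubic a).baseChange (AlgebraicClosure F)).toAffine.Nonsingular x y) :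
    y - sqrt a * x ≠ 0 ∧ y + sqrt a * x ≠ 0 := by
  have hu := (Additive.toMul (nodeMap a (.some x y h))).ne_zero
  rw [coe_nodeMap_some ha h] at hu
  exact ⟨fun h0 ↦ hu (by rw [h0, zero_div]), fun h0 ↦ hu (by rw [h0, div_zero])⟩

/-! ### The Galois action -/

/-- Every `σ ∈ Γ_F` maps `√a` to `√a` or to `-√a` (it fixes `a`). [folklore] -/
theorem smul_sqrt_eq_or (σ : Field.absoluteGaloisGroup F) :
    σ • sqrt a = sqrt a ∨ σ • sqrt a = -sqrt a := by
  have h : (σ • sqrt a) ^ 2 = sqrt a ^ 2 := by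
    rw [Field.absoluteGaloisGroup.smul_def, ← map_pow, sqrt_sq, AlgEquiv.commutes]
  exact sq_eq_sq_iff_eq_or_eq_neg.mp h

/-- The action of `σ ∈ Γ_F` on an affine point of `E_ns(F̄)` is coordinatewise
(`GaloisAction`: `σ • P = Point.map σ P`; Mathlib `Affine.Point.map_some`). [folklore] -/
theorem smul_some (σ : Field.absoluteGaloisGroup F) {x y : AlgebraicClosure F}
    (h : ((nodalCubic a).baseChange (AlgebraicClosure F)).toAffine.Nonsingular x y) :
    ∃ h' : ((nodalCubic a).baseChange (AlgebraicClosure F)).toAffine.Nonsingular (σ • x) (σ • y),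
      @HSMul.hSMul (Field.absoluteGaloisGroup F) (geomPoints (nodalCubic a))
          (geomPoints (nodalCubic a)) _ σ (.some x y h) = .some (σ • x) (σ • y) h' :=
  ⟨_, by
    change Affine.Point.map
      ((Field.absoluteGaloisGroup.toAlgEquiv F σ : AlgebraicClosure F ≃ₐ[F] AlgebraicClosure F) :
        AlgebraicClosure F →ₐ[F] AlgebraicClosure F) (.some x y h) = _
    rw [Affine.Point.map_some]
    rfl⟩

/-- The node map of `O` is `1`. [folklore] -/
theorem coe_nodeMap_zero :
    ((Additive.toMul (nodeMap a (0 : geomPoints (nodalCubic a))) : (AlgebraicClosure F)ˣ) :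
      AlgebraicClosure F) = 1 := by
  rw [map_zero, toMul_zero, Units.val_one]

/-- **The twist, trivial case.**  If `σ ∈ Γ_F` fixes `√a`, the node map is `σ`-equivariant:
`nodeMap (σ • P) = σ (nodeMap P)`.  Silverman, *AEC*, Exercise 3.5 (split case).
[cite: SilvermanAEC2009, Exercise 3.5] -/
theorem coe_nodeMap_smul_of_smul_sqrt_eq (ha : 2 * a ≠ 0) {σ : Field.absoluteGaloisGroup F}
    (hσ : σ • sqrt a = sqrt a) (P : geomPoints (nodalCubic a)) :
    ((Additive.toMul (nodeMap a (σ • P)) : (AlgebraicClosure F)ˣ) : AlgebraicClosure F) =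
      σ • ((Additive.toMul (nodeMap a P) : (AlgebraicClosure F)ˣ) : AlgebraicClosure F) := by
  rcases P with _ | ⟨x, y, h⟩
  · change (((Additive.toMul (nodeMap a (σ • (0 : geomPoints (nodalCubic a))))) :
        (AlgebraicClosure F)ˣ) : AlgebraicClosure F) =
          σ • ((Additive.toMul (nodeMap a 0) : (AlgebraicClosure F)ˣ) : AlgebraicClosure F)
    rw [smul_zero, coe_nodeMap_zero, Field.absoluteGaloisGroup.smul_def, map_one]
  · obtain ⟨h', e⟩ := smul_some σ h
    have hσ' : Field.absoluteGaloisGroup.toAlgEquiv F σ (sqrt a) = sqrt a := hσ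
    rw [e, coe_nodeMap_some ha h', coe_nodeMap_some ha h, Field.absoluteGaloisGroup.smul_def,
      Field.absoluteGaloisGroup.smul_def, Field.absoluteGaloisGroup.smul_def, map_div₀, map_sub,
      map_add, map_mul, hσ']

/-- **The twist, non-trivial case.**  If `σ ∈ Γ_F` maps `√a` to `-√a`, the node map is
anti-equivariant: `nodeMap (σ • P) = σ (nodeMap P)⁻¹` — the Galois module `E_ns(F̄)` is `F̄ˣ`
twisted by the quadratic character of `F(√a)/F`.  Silverman, *AEC*, Exercise 3.5.
[cite: SilvermanAEC2009, Exercise 3.5] -/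
theorem coe_nodeMap_smul_of_smul_sqrt_eq_neg (ha : 2 * a ≠ 0) {σ : Field.absoluteGaloisGroup F}
    (hσ : σ • sqrt a = -sqrt a) (P : geomPoints (nodalCubic a)) :
    ((Additive.toMul (nodeMap a (σ • P)) : (AlgebraicClosure F)ˣ) : AlgebraicClosure F) =
      (σ • ((Additive.toMul (nodeMap a P) : (AlgebraicClosure F)ˣ) : AlgebraicClosure F))⁻¹ := by
  rcases P with _ | ⟨x, y, h⟩
  · change (((Additive.toMul (nodeMap a (σ • (0 : geomPoints (nodalCubic a))))) :
        (AlgebraicClosure F)ˣ) : AlgebraicClosure F) =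
          (σ • ((Additive.toMul (nodeMap a 0) : (AlgebraicClosure F)ˣ) : AlgebraicClosure F))⁻¹
    rw [smul_zero, coe_nodeMap_zero, Field.absoluteGaloisGroup.smul_def, map_one, inv_one]
  · obtain ⟨h', e⟩ := smul_some σ h
    have hσ' : Field.absoluteGaloisGroup.toAlgEquiv F σ (sqrt a) = -sqrt a := hσ
    rw [e, coe_nodeMap_some ha h', coe_nodeMap_some ha h, Field.absoluteGaloisGroup.smul_def,
      Field.absoluteGaloisGroup.smul_def, Field.absoluteGaloisGroup.smul_def, map_div₀, map_sub,
      map_add, map_mul, hσ', inv_div]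
    congr 1 <;> ring

/-! ### Torsion points and roots of unity -/

/-- **Torsion points of the node are roots of unity**: `n • P = 0 ↔ (nodeMap P) ^ n = 1`
(`2a ≠ 0`; the node map is an injective homomorphism to `F̄ˣ`).  Silverman, *AEC*,
Prop. III.2.5(a), Exercise 3.5. [cite: SilvermanAEC2009, Prop. III.2.5(a)] -/
theorem nsmul_eq_zero_iff (ha : 2 * a ≠ 0) (n : ℕ) (P : geomPoints (nodalCubic a)) :
    n • P = 0 ↔ ((Additive.toMul (nodeMap a P) : (AlgebraicClosure F)ˣ) :
      AlgebraicClosure F) ^ n = 1 := by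
  rw [← (nodeMap_injective ha).eq_iff, map_nsmul, map_zero, ← Additive.toMul.injective.eq_iff,
    toMul_nsmul, toMul_zero, Units.ext_iff, Units.val_pow_eq_pow_val, Units.val_one]

/-- `E_ns(F̄)[n]` is finite for every `n ≥ 1` (`2a ≠ 0`): it embeds into the `n`-th roots of
unity of `F̄`. Silverman, *AEC*, Prop. III.2.5(a). [cite: SilvermanAEC2009, Prop. III.2.5(a)] -/
theorem finite_torsionBy (ha : 2 * a ≠ 0) {n : ℕ} (hn : 0 < n) :
    Finite ((geomPoints (nodalCubic a))[(n : ℕ)]) := by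
  haveI : NeZero n := ⟨hn.ne'⟩
  let f : (geomPoints (nodalCubic a))[(n : ℕ)] → rootsOfUnity n (AlgebraicClosure F) :=
    fun P ↦ ⟨Additive.toMul (nodeMap a (P : geomPoints (nodalCubic a))), by
      rw [mem_rootsOfUnity, Units.ext_iff, Units.val_pow_eq_pow_val, Units.val_one]
      exact (nsmul_eq_zero_iff ha n _).mp (AddSubgroup.torsionBy.nsmul_iff.mp P.2)⟩
  refine Finite.of_injective f fun P Q hPQ ↦ Subtype.ext (nodeMap_injective ha ?_)
  exact Additive.toMul.injective (congrArg Subtype.val hPQ)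

/-- **Inertia-type elements act trivially on torsion when they fix `√a`.**  If `σ ∈ Γ_F` fixes
`√a` and fixes every `t ∈ F̄` with `t ^ n = 1`, then `σ • P = P` for every `P ∈ E_ns(F̄)` with
`n • P = 0`.  Silverman, *AEC*, Exercise 3.5. [cite: SilvermanAEC2009, Exercise 3.5] -/
theorem smul_eq_self_of_smul_sqrt_eq (ha : 2 * a ≠ 0) {σ : Field.absoluteGaloisGroup F}
    (hσ : σ • sqrt a = sqrt a) {n : ℕ}
    (hroots : ∀ t : AlgebraicClosure F, t ^ n = 1 → σ • t = t)
    {P : geomPoints (nodalCubic a)} (hP : n • P = 0) : σ • P = P := by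
  apply nodeMap_injective ha
  apply Additive.toMul.injective
  ext
  rw [coe_nodeMap_smul_of_smul_sqrt_eq ha hσ, hroots _ ((nsmul_eq_zero_iff ha n P).mp hP)]

/-- **The twisting element acts as `-1` on torsion.**  If `σ ∈ Γ_F` maps `√a` to `-√a` and fixes
every `t ∈ F̄` with `t ^ n = 1`, then `σ • P = -P` for every `P ∈ E_ns(F̄)` with `n • P = 0`.
Silverman, *AEC*, Exercise 3.5. [cite: SilvermanAEC2009, Exercise 3.5] -/
theorem smul_eq_neg_of_smul_sqrt_eq_neg (ha : 2 * a ≠ 0) {σ : Field.absoluteGaloisGroup F}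
    (hσ : σ • sqrt a = -sqrt a) {n : ℕ}
    (hroots : ∀ t : AlgebraicClosure F, t ^ n = 1 → σ • t = t)
    {P : geomPoints (nodalCubic a)} (hP : n • P = 0) : σ • P = -P := by
  apply nodeMap_injective ha
  apply Additive.toMul.injective
  ext
  rw [coe_nodeMap_smul_of_smul_sqrt_eq_neg ha hσ, hroots _ ((nsmul_eq_zero_iff ha n P).mp hP),
    map_neg, toMul_neg, Units.val_inv_eq_inv_val]

end nodalCubic

end WeierstrassCurve

end
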